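import Summits.HodgeConjecture.HodgeConjecture.Theorems.R90S9SignedClauseCongrTransport     -- ★ p861743 (this seat): witness transport `charIdentityAtTestSigned_pair_transport_formCongr`, sign lemmas; brings ★ p861691, ★ p02 class law
import Summits.HodgeConjecture.HodgeConjecture.Theorems.R90S9PisEqOfCharIdentityAtTestSigned   -- ★ p861411 (this seat): `πs_eq_of_charIdentityAtTestSigned` (signed completion uniqueness)
import Summits.HodgeConjecture.HodgeConjecture.Theorems.F0P3cStCharTSOfQuasiSplitTransfer     -- ★ (d4) `isLocalDeltaTransferExists_model_of_formCongr`
import Summits.HodgeConjecture.HodgeConjecture.Theorems.F0P3cDbTEnvelopeTrichotomy            -- ★ `comap_cmDatumLocalCongr_symm_eq` (frame independence of transported classes, K5)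
import HarnessLib

/-!
# R90-TF · S9 «InnerForm-13.3.6 (c)» — (B3d, value law) THE `πˢ` READ OFF THE SIGNED Q-PACKAGE RIDES THE SIMILITUDE: `hId.πs ∘ e_v = hId₀.πs`

Cell `hodgecm-mathlib`, crux H413 (`stmt-HodgeConjecture-24833`, lane `--supports`), route of record `HCCMUnconditional` (no route verbs; count-neutral).  Programme
R90-TF (brief `director/R90-BRIEF.v2.md` 1f40d54518340a35), section S9 (base `R90-IF`); seat R90-IF-p03 (g0), RE-DEAL «B3d» (R90-IF-plan (g0) 2026-09-04T15:43:02Z: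
«… WITH the value law `(hQS₀ ξ).1 v … .πs` corresponds to `(hQS ξ).1 v … .πs` under `IrrClass.comap` of the frame change — by ★ `πs_eq_of_charIdentityAtTestSigned` this law
is FORCED»), census `R90/R90-IF-p03/g0/CENSUS-B3d.md` §1 «(d3) value law» ∕ §2 third disjunct.  THEOREMS ONLY, sorry-free, over ★ currency.  HONEST LABEL: HC_CM is proved only
modulo the 7 printed citations (2 remaining named inputs: hLiu418 = stmt-HodgeConjecture-24832, h413 = stmt-HodgeConjecture-24833) until rung 0 closes; this file proves no
printed statement — it is the read-back step of the B3 glue (p02's cut `similitudeTransport_of_parts`, third disjunct of (B0)).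

THE MATHEMATICS [Rogawski1990 §13.1 Prop. 13.1.3 (d) p. 199: the supercuspidal completing `πⁿ` in (13.1.4) is UNIQUE; §14.2 pp. 232–234].  At a non-split `v`, with the
H-frame of the similitude `(T_v, a_v)` (`e_v := cmDatumLocalCongr L v T_v …`, Φ₃-side data `D₀ = (Δ‴_{Φ₃}, m_H, e_v⁻¹_* m_G, e_v⁻¹_* ν_G, ν_H)`) and G-surjective matching
(H₇) at `D`: take ANY H-frame `(T, a′)` with its signed letter `hId` at `D` (class `πⁿ ∘ e_T⁻¹`, sign `ε(a′)`) and ANY Φ₃-self-frame `(T″, a″)` with a signed letter `hId₀` at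
`D₀` (class `πⁿ ∘ e_{T″}⁻¹`, sign `ε(a″)`).  Then **`IrrClass.comap e_v hId.πs = hId₀.πs`**: (i) `(πⁿ ∘ e_T⁻¹) ∘ e_v = πⁿ ∘ e_{T″}⁻¹` — transported classes do not see the
frame (★ `comap_cmDatumLocalCongr_symm_eq`, K5: `N = 3` odd; then ★ p02 `comap_comap_symm_cmDatumLocalCongr_mul` at the product frame `T_v·T″`); (ii) `hId.πs ∘ e_v` completes
that class at `D₀` with sign `χ(a_v)·ε(a′) = ε_v(H)² = 1 = ε(a″)` (★ witness transport p861743 §3 + sign constancy); (iii) so does `hId₀.πs`; (iv) (H₇) rides to `D₀` (★ (d4)),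
hence uniqueness on the model (★ p861411) identifies them.  Consequently in the B3 glue the third disjunct of (B0) at `qsForm L` — `comap e_v c = (hQS₀ …).πs` — reads back as
`c = (hQS …).πs` by ★ `IrrClass.comap_injective`.

* §1 `intCast_clauseSign_mul_clauseSign_eq_of_frames` — `χ(a_v)·ε(a′) = ε(a″)` for two H-frames and a Φ₃-frame.
* §2 **`comap_signedPis_eq_signedPis_transport`** — the value law (statement above), for ARBITRARY letters `hId`, `hId₀` (in the glue: `(hQS ξ).1 v hns T a′ …` and
  `(hQS₀ ξ).1 v hns T″ a″ …`); **`eq_signedPis_of_comap_eq_transport`** — the read-back `comap e_v c = hId₀.πs → c = hId.πs`.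

## References
* [Rogawski1990] J. D. Rogawski, *Automorphic Representations of Unitary Groups in Three Variables*, Ann. of Math. Stud. 123 (1990): §13.1 Prop. 13.1.3 (d), Prop. 13.1.4
  p. 199; §14.2 pp. 232–234; §14.6 p. 242; §4.9 Prop. 4.9.1 (a) p. 55.
* [LanglandsShelstad1987] R. P. Langlands, D. Shelstad, *On the definition of transfer factors*, Math. Ann. 278 (1987): §1, §4.2.
-/

set_option autoImplicit false
-- the mandated namespace repeats `HodgeConjecture.HodgeConjecture`, as in every `Theorems/*.lean` of this sub-problem
set_option linter.dupNamespace false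

noncomputable section

open NumberField IsDedekindDomain MeasureTheory MeasureTheory.Measure
open scoped Matrix MatrixGroups
open Literature.NumberTheory.Rogawski1990 Literature.NumberTheory.Automorphic Literature.NumberTheory.Automorphic.UnitaryGroup
open Literature.NumberTheory.GaloisRepresentations
open Summit.HodgeConjecture.HodgeConjecture.Cruxes.H413

namespace Summit.HodgeConjecture.HodgeConjecture.R90.S9

/-! ## §1 Sign constancy for two H-frames and a Φ₃-frame -/

section Sign

variable (L : Type) [Field L] [NumberField L] [IsCMField L] (H : Matrix (Fin 3) (Fin 3) L)
  (v : HeightOneSpectrum (𝓞 ↥(maximalRealSubfield L)))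

open scoped Classical in
/-- **`χ(a_v) · ε(a′) = ε(a″)`** for two H-frames `(T_v, a_v)` (`χ` in the `ℤ`-cast spelling), `(T, a′)` and a Φ₃-self-frame `(T″, a″)` at a non-split `v`: both H-signs are
`ε_v(H)` (★ `clauseSign_eq_intCast_formSignAt`), `ε_v(H)² = 1`, and `ε(a″) = 1` (★ `clauseSign_antidiag_frame_eq_one`). [cite: Rogawski1990, §14.6 p. 242] [cite: LanglandsShelstad1987, §1] -/
theorem intCast_clauseSign_mul_clauseSign_eq_of_frames (hH : (H.map (cmConjRingHom L))ᵀ = H)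
    (hns : ∀ w : PlacesOver L v, IsCMField.complexConj L • w.1 = w.1)
    (Tᵥ : GL (Fin 3) (LocalRing L v)) (aᵥ : LocalRing L v) (haᵥ : IsUnit aᵥ)
    (hᵥ : formCongr (conjLocal L (IsCMField.complexConj L) v) Tᵥ (H.map (algebraMap L (LocalRing L v))) =
      aᵥ • (Matrix.of fun i j : Fin 3 => if i.val + j.val + 1 = 3 then (1 : L) else 0).map (algebraMap L (LocalRing L v)))
    (T : GL (Fin 3) (LocalRing L v)) (a' : LocalRing L v) (ha' : IsUnit a')
    (h' : formCongr (conjLocal L (IsCMField.complexConj L) v) T (H.map (algebraMap L (LocalRing L v))) =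
      a' • (Matrix.of fun i j : Fin 3 => if i.val + j.val + 1 = 3 then (1 : L) else 0).map (algebraMap L (LocalRing L v)))
    (T'' : GL (Fin 3) (LocalRing L v)) (a'' : LocalRing L v) (ha'' : IsUnit a'')
    (h'' : formCongr (conjLocal L (IsCMField.complexConj L) v) T''
        ((Matrix.of fun i j : Fin 3 => if i.val + j.val + 1 = 3 then (1 : L) else 0).map (algebraMap L (LocalRing L v))) =
      a'' • (Matrix.of fun i j : Fin 3 => if i.val + j.val + 1 = 3 then (1 : L) else 0).map (algebraMap L (LocalRing L v))) :
    (((if ∃ z : LocalRing L v, IsUnit z ∧ aᵥ = z * conjLocal L (IsCMField.complexConj L) v z then (1 : ℤ) else -1 : ℤ) : ℂ)) *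
        (if ∃ z : LocalRing L v, IsUnit z ∧ a' = z * conjLocal L (IsCMField.complexConj L) v z then (1 : ℂ) else -1) =
      (if ∃ z : LocalRing L v, IsUnit z ∧ a'' = z * conjLocal L (IsCMField.complexConj L) v z then (1 : ℂ) else -1) := by
  have hcast : (((if ∃ z : LocalRing L v, IsUnit z ∧ aᵥ = z * conjLocal L (IsCMField.complexConj L) v z then (1 : ℤ) else -1 : ℤ) : ℂ)) =
      (if ∃ z : LocalRing L v, IsUnit z ∧ aᵥ = z * conjLocal L (IsCMField.complexConj L) v z then (1 : ℂ) else -1) := by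
    split_ifs <;> simp
  rw [hcast, clauseSign_eq_intCast_formSignAt L H hH v hns Tᵥ aᵥ haᵥ hᵥ, clauseSign_eq_intCast_formSignAt L H hH v hns T a' ha' h', intCast_formSignAt_mul_self,
    clauseSign_antidiag_frame_eq_one L v hns T'' a'' ha'' h'']

end Sign

/-! ## §2 The value law -/

section ValueLaw

variable (L : Type) [Field L] [NumberField L] [IsCMField L] (H : Matrix (Fin 3) (Fin 3) L)
  (v : HeightOneSpectrum (𝓞 ↥(maximalRealSubfield L)))

open scoped Classical in
set_option synthInstance.maxHeartbeats 400000 in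
set_option maxHeartbeats 8000000 in
/-- **(B3d, value law) `hId.πs ∘ e_v = hId₀.πs`.**  At a non-split `v`, hermitian `H` with unit determinant, the H-frame of the similitude `(T_v, a_v)`
(`e_v := cmDatumLocalCongr L v T_v ha_v h_v`), Haar `ν_G`, orbital families `(m_H, m_G)` with G-surjective matching on `C_c^∞` at `Δ‴_H` ((H₇)), `H`-side data `(ν_H, ξ_v)`:
for ANY H-frame `(T, a′)` with a signed letter `hId` (class `πⁿ ∘ e_T⁻¹`, sign `ε(a′)`, data `D`) and ANY Φ₃-self-frame `(T″, a″)` with a signed letter `hId₀` (class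
`πⁿ ∘ e_{T″}⁻¹`, sign `ε(a″)`, data `D₀ = (Δ‴_{Φ₃}, m_H, e_v⁻¹_* m_G, e_v⁻¹_* ν_G, ν_H)`): `IrrClass.comap e_v hId.πs = hId₀.πs` — frame independence of the class (★ K5), witness
transport (★ p861743), sign constancy (§1), (H₇) on the model (★ (d4)) and uniqueness of the signed completion (★ p861411).
[cite: Rogawski1990, §13.1 Prop. 13.1.3 (d), Prop. 13.1.4 p. 199; §14.2 pp. 232–234; §4.9 Prop. 4.9.1 (a) p. 55] [cite: LanglandsShelstad1987, §4.2] -/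
theorem comap_signedPis_eq_signedPis_transport (μ : HeckeCharacter L)
    (w : PlacesOver L v) (hw : IsCMField.complexConj L • w.1 = w.1) (hns : ∀ w : PlacesOver L v, IsCMField.complexConj L • w.1 = w.1)
    (hH : (H.map (cmConjRingHom L))ᵀ = H) (hHd : IsUnit H.det)
    (Tᵥ : GL (Fin 3) (UnitaryGroup.LocalRing L v)) {aᵥ : UnitaryGroup.LocalRing L v} (haᵥ : IsUnit aᵥ)
    (haσ : conjLocal L (IsCMField.complexConj L) v aᵥ = aᵥ)
    (hᵥ : formCongr (conjLocal L (IsCMField.complexConj L) v) Tᵥ (H.map (algebraMap L (UnitaryGroup.LocalRing L v))) =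
      aᵥ • (Matrix.of fun i j : Fin 3 => if i.val + j.val + 1 = 3 then (1 : L) else 0).map (algebraMap L (UnitaryGroup.LocalRing L v)))
    [MeasurableSpace ((UnitaryGroup.cmDatum L 3 H).Local v)] [BorelSpace ((UnitaryGroup.cmDatum L 3 H).Local v)]
    [MeasurableSpace ((UnitaryGroup.cmDatum L 3 (Matrix.of fun i j : Fin 3 => if i.val + j.val + 1 = 3 then (1 : L) else 0)).Local v)]
    [BorelSpace ((UnitaryGroup.cmDatum L 3 (Matrix.of fun i j : Fin 3 => if i.val + j.val + 1 = 3 then (1 : L) else 0)).Local v)]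
    [∀ γ : (UnitaryGroup.cmDatum L 3 H).Local v, MeasurableSpace (((UnitaryGroup.cmDatum L 3 H).Local v) ⧸ Subgroup.centralizer ({γ} : Set ((UnitaryGroup.cmDatum L 3 H).Local v)))]
    [∀ γ : (UnitaryGroup.cmDatum L 3 H).Local v, BorelSpace (((UnitaryGroup.cmDatum L 3 H).Local v) ⧸ Subgroup.centralizer ({γ} : Set ((UnitaryGroup.cmDatum L 3 H).Local v)))]
    [∀ γ : (UnitaryGroup.cmDatum L 3 (Matrix.of fun i j : Fin 3 => if i.val + j.val + 1 = 3 then (1 : L) else 0)).Local v,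
      MeasurableSpace (((UnitaryGroup.cmDatum L 3 (Matrix.of fun i j : Fin 3 => if i.val + j.val + 1 = 3 then (1 : L) else 0)).Local v) ⧸
        Subgroup.centralizer ({γ} : Set ((UnitaryGroup.cmDatum L 3 (Matrix.of fun i j : Fin 3 => if i.val + j.val + 1 = 3 then (1 : L) else 0)).Local v)))]
    [∀ γ : (UnitaryGroup.cmDatum L 3 (Matrix.of fun i j : Fin 3 => if i.val + j.val + 1 = 3 then (1 : L) else 0)).Local v,
      BorelSpace (((UnitaryGroup.cmDatum L 3 (Matrix.of fun i j : Fin 3 => if i.val + j.val + 1 = 3 then (1 : L) else 0)).Local v) ⧸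
        Subgroup.centralizer ({γ} : Set ((UnitaryGroup.cmDatum L 3 (Matrix.of fun i j : Fin 3 => if i.val + j.val + 1 = 3 then (1 : L) else 0)).Local v)))]
    [MeasurableSpace ((UnitaryGroup.cmDatum L 2 (Matrix.of fun i j : Fin 2 => if i.val + j.val + 1 = 2 then (1 : L) else 0)).Local v ×
      (UnitaryGroup.cmDatum L 1 (Matrix.of fun i j : Fin 1 => if i.val + j.val + 1 = 1 then (1 : L) else 0)).Local v)]
    [BorelSpace ((UnitaryGroup.cmDatum L 2 (Matrix.of fun i j : Fin 2 => if i.val + j.val + 1 = 2 then (1 : L) else 0)).Local v ×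
      (UnitaryGroup.cmDatum L 1 (Matrix.of fun i j : Fin 1 => if i.val + j.val + 1 = 1 then (1 : L) else 0)).Local v)]
    [∀ a' : (UnitaryGroup.cmDatum L 2 (Matrix.of fun i j : Fin 2 => if i.val + j.val + 1 = 2 then (1 : L) else 0)).Local v ×
        (UnitaryGroup.cmDatum L 1 (Matrix.of fun i j : Fin 1 => if i.val + j.val + 1 = 1 then (1 : L) else 0)).Local v,
      MeasurableSpace (((UnitaryGroup.cmDatum L 2 (Matrix.of fun i j : Fin 2 => if i.val + j.val + 1 = 2 then (1 : L) else 0)).Local v ×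
          (UnitaryGroup.cmDatum L 1 (Matrix.of fun i j : Fin 1 => if i.val + j.val + 1 = 1 then (1 : L) else 0)).Local v) ⧸
        Subgroup.centralizer ({a'} : Set ((UnitaryGroup.cmDatum L 2 (Matrix.of fun i j : Fin 2 => if i.val + j.val + 1 = 2 then (1 : L) else 0)).Local v ×
          (UnitaryGroup.cmDatum L 1 (Matrix.of fun i j : Fin 1 => if i.val + j.val + 1 = 1 then (1 : L) else 0)).Local v)))]
    [∀ a' : (UnitaryGroup.cmDatum L 2 (Matrix.of fun i j : Fin 2 => if i.val + j.val + 1 = 2 then (1 : L) else 0)).Local v ×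
        (UnitaryGroup.cmDatum L 1 (Matrix.of fun i j : Fin 1 => if i.val + j.val + 1 = 1 then (1 : L) else 0)).Local v,
      BorelSpace (((UnitaryGroup.cmDatum L 2 (Matrix.of fun i j : Fin 2 => if i.val + j.val + 1 = 2 then (1 : L) else 0)).Local v ×
          (UnitaryGroup.cmDatum L 1 (Matrix.of fun i j : Fin 1 => if i.val + j.val + 1 = 1 then (1 : L) else 0)).Local v) ⧸
        Subgroup.centralizer ({a'} : Set ((UnitaryGroup.cmDatum L 2 (Matrix.of fun i j : Fin 2 => if i.val + j.val + 1 = 2 then (1 : L) else 0)).Local v ×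
          (UnitaryGroup.cmDatum L 1 (Matrix.of fun i j : Fin 1 => if i.val + j.val + 1 = 1 then (1 : L) else 0)).Local v)))]
    (mHv : OrbitalMeasureFamily ((UnitaryGroup.cmDatum L 2 (Matrix.of fun i j : Fin 2 => if i.val + j.val + 1 = 2 then (1 : L) else 0)).Local v ×
      (UnitaryGroup.cmDatum L 1 (Matrix.of fun i j : Fin 1 => if i.val + j.val + 1 = 1 then (1 : L) else 0)).Local v))
    (mGv : OrbitalMeasureFamily ((UnitaryGroup.cmDatum L 3 H).Local v))
    (νG : Measure ((UnitaryGroup.cmDatum L 3 H).Local v)) [νG.IsHaarMeasure]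
    (νH : Measure ((UnitaryGroup.cmDatum L 2 (Matrix.of fun i j : Fin 2 => if i.val + j.val + 1 = 2 then (1 : L) else 0)).Local v ×
      (UnitaryGroup.cmDatum L 1 (Matrix.of fun i j : Fin 1 => if i.val + j.val + 1 = 1 then (1 : L) else 0)).Local v))
    (ξv : (UnitaryGroup.cmDatum L 2 (Matrix.of fun i j : Fin 2 => if i.val + j.val + 1 = 2 then (1 : L) else 0)).Local v ×
      (UnitaryGroup.cmDatum L 1 (Matrix.of fun i j : Fin 1 => if i.val + j.val + 1 = 1 then (1 : L) else 0)).Local v →* ℂˣ)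
    -- (H₇) at `v` on the `H` side
    (hex : IsLocalDeltaTransferExists L H v ((finExplicitCollection L H μ (finExplicitDelta_conj_left_all L H μ) (finExplicitDelta_conj_right_all L H μ)) v) mHv mGv
      IsLocSmooth IsLocSmooth)
    -- any H-frame `(T, a′)` with its signed letter
    (T : GL (Fin 3) (UnitaryGroup.LocalRing L v)) {a' : UnitaryGroup.LocalRing L v} (ha' : IsUnit a')
    (h' : formCongr (conjLocal L (IsCMField.complexConj L) v) T (H.map (algebraMap L (UnitaryGroup.LocalRing L v))) =
      a' • (Matrix.of fun i j : Fin 3 => if i.val + j.val + 1 = 3 then (1 : L) else 0).map (algebraMap L (UnitaryGroup.LocalRing L v)))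
    (πn : IrrClass (Gqs L v))
    (hId : CMNonsplitCharIdentityAtTestSigned L v H
      ((finExplicitCollection L H μ (finExplicitDelta_conj_left_all L H μ) (finExplicitDelta_conj_right_all L H μ)) v) mHv mGv νG νH ξv
      (if ∃ z : UnitaryGroup.LocalRing L v, IsUnit z ∧ a' = z * conjLocal L (IsCMField.complexConj L) v z then (1 : ℂ) else -1)
      (IrrClass.comap (cmDatumLocalCongr L v T ha' h').symm πn))
    -- any Φ₃-self-frame `(T″, a″)` with a signed letter at the transported data
    (T'' : GL (Fin 3) (UnitaryGroup.LocalRing L v)) {a'' : UnitaryGroup.LocalRing L v} (ha'' : IsUnit a'')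
    (h'' : formCongr (conjLocal L (IsCMField.complexConj L) v) T''
        ((Matrix.of fun i j : Fin 3 => if i.val + j.val + 1 = 3 then (1 : L) else 0).map (algebraMap L (UnitaryGroup.LocalRing L v))) =
      a'' • (Matrix.of fun i j : Fin 3 => if i.val + j.val + 1 = 3 then (1 : L) else 0).map (algebraMap L (UnitaryGroup.LocalRing L v)))
    (hId₀ : CMNonsplitCharIdentityAtTestSigned L v (Matrix.of fun i j : Fin 3 => if i.val + j.val + 1 = 3 then (1 : L) else 0)
      ((finExplicitCollection L (Matrix.of fun i j : Fin 3 => if i.val + j.val + 1 = 3 then (1 : L) else 0) μ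
        (finExplicitDelta_conj_left_all L (Matrix.of fun i j : Fin 3 => if i.val + j.val + 1 = 3 then (1 : L) else 0) μ)
        (finExplicitDelta_conj_right_all L (Matrix.of fun i j : Fin 3 => if i.val + j.val + 1 = 3 then (1 : L) else 0) μ)) v) mHv
      (mGv.transport (cmDatumLocalCongr L v Tᵥ haᵥ hᵥ).symm.toMulEquiv (cmDatumLocalCongr L v Tᵥ haᵥ hᵥ).symm.continuous (cmDatumLocalCongr L v Tᵥ haᵥ hᵥ).continuous)
      (νG.map (cmDatumLocalCongr L v Tᵥ haᵥ hᵥ).symm) νH ξv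
      (if ∃ z : UnitaryGroup.LocalRing L v, IsUnit z ∧ a'' = z * conjLocal L (IsCMField.complexConj L) v z then (1 : ℂ) else -1)
      (IrrClass.comap (cmDatumLocalCongr L v T'' ha'' h'').symm πn)) :
    IrrClass.comap (cmDatumLocalCongr L v Tᵥ haᵥ hᵥ) hId.πs = hId₀.πs := by
  -- the product H-frame `(T_v·T″, a_v·a″)`
  have hcomp : formCongr (conjLocal L (IsCMField.complexConj L) v) (Tᵥ * T'') (H.map (algebraMap L (UnitaryGroup.LocalRing L v))) =
      (aᵥ * a'') • (Matrix.of fun i j : Fin 3 => if i.val + j.val + 1 = 3 then (1 : L) else 0).map (algebraMap L (UnitaryGroup.LocalRing L v)) :=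
    formCongr_mul_eq_mul_smul_of_formCongr_eq_smul L v T'' Tᵥ h'' hᵥ
  -- (i) the class: `(πⁿ ∘ e_T⁻¹) ∘ e_v = (πⁿ ∘ e_{T_vT″}⁻¹) ∘ e_v = πⁿ ∘ e_{T″}⁻¹`
  have hcls : IrrClass.comap (cmDatumLocalCongr L v Tᵥ haᵥ hᵥ) (IrrClass.comap (cmDatumLocalCongr L v T ha' h').symm πn) =
      IrrClass.comap (cmDatumLocalCongr L v T'' ha'' h'').symm πn := by
    rw [F0P3cDbTEnvelopeTrichotomy.comap_cmDatumLocalCongr_symm_eq L H hH T (Tᵥ * T'') ha' (haᵥ.mul ha'') h' hcomp πn]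
    exact comap_comap_symm_cmDatumLocalCongr_mul L v T'' Tᵥ ha'' haᵥ (haᵥ.mul ha'') h'' hᵥ hcomp πn
  -- (ii) the witness `hId.πs ∘ e_v` completes that class at `D₀`, sign `χ(a_v)·ε(a′) = ε(a″)`
  have hW := charIdentityAtTestSigned_pair_transport_formCongr L H v μ w hw hH hHd Tᵥ haᵥ haσ hᵥ mHv mGv νG νH ξv
    (if ∃ z : UnitaryGroup.LocalRing L v, IsUnit z ∧ a' = z * conjLocal L (IsCMField.complexConj L) v z then (1 : ℂ) else -1)
    (IrrClass.comap (cmDatumLocalCongr L v T ha' h').symm πn) hId.πs hId.charIdentityAtTestSigned_πs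
  rw [hcls, intCast_clauseSign_mul_clauseSign_eq_of_frames L H v hH hns Tᵥ aᵥ haᵥ hᵥ T a' ha' h' T'' a'' ha'' h''] at hW
  -- (iii)+(iv) (H₇) rides to the model; uniqueness there
  have hex₀ := F0P3cStCharTSOfQuasiSplit.isLocalDeltaTransferExists_model_of_formCongr L H μ v w hw hH hHd.ne_zero Tᵥ haᵥ haσ hᵥ mHv mGv hex
  have hε0 : (if ∃ z : UnitaryGroup.LocalRing L v, IsUnit z ∧ a'' = z * conjLocal L (IsCMField.complexConj L) v z then (1 : ℂ) else -1) ≠ 0 := by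
    split_ifs <;> norm_num
  exact πs_eq_of_charIdentityAtTestSigned L (Matrix.of fun i j : Fin 3 => if i.val + j.val + 1 = 3 then (1 : L) else 0) v (antidiagOne_isHermitian L 3)
    (isUnit_antidiagOne_det L 3) hex₀ (νG.map (cmDatumLocalCongr L v Tᵥ haᵥ hᵥ).symm) hε0 hId₀ hW

open scoped Classical in
set_option synthInstance.maxHeartbeats 400000 in
set_option maxHeartbeats 8000000 in
/-- **(B3d, read-back) `comap e_v c = hId₀.πs → c = hId.πs`** — the third disjunct of (B0) at `qsForm L` read back on `U(H)_v` (value law + ★ `IrrClass.comap_injective`); same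
hypotheses as `comap_signedPis_eq_signedPis_transport`. [cite: Rogawski1990, §13.1 Prop. 13.1.3 (d) p. 199; §14.2 pp. 232–234] -/
theorem eq_signedPis_of_comap_eq_transport (μ : HeckeCharacter L)
    (w : PlacesOver L v) (hw : IsCMField.complexConj L • w.1 = w.1) (hns : ∀ w : PlacesOver L v, IsCMField.complexConj L • w.1 = w.1)
    (hH : (H.map (cmConjRingHom L))ᵀ = H) (hHd : IsUnit H.det)
    (Tᵥ : GL (Fin 3) (UnitaryGroup.LocalRing L v)) {aᵥ : UnitaryGroup.LocalRing L v} (haᵥ : IsUnit aᵥ)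
    (haσ : conjLocal L (IsCMField.complexConj L) v aᵥ = aᵥ)
    (hᵥ : formCongr (conjLocal L (IsCMField.complexConj L) v) Tᵥ (H.map (algebraMap L (UnitaryGroup.LocalRing L v))) =
      aᵥ • (Matrix.of fun i j : Fin 3 => if i.val + j.val + 1 = 3 then (1 : L) else 0).map (algebraMap L (UnitaryGroup.LocalRing L v)))
    [MeasurableSpace ((UnitaryGroup.cmDatum L 3 H).Local v)] [BorelSpace ((UnitaryGroup.cmDatum L 3 H).Local v)]
    [MeasurableSpace ((UnitaryGroup.cmDatum L 3 (Matrix.of fun i j : Fin 3 => if i.val + j.val + 1 = 3 then (1 : L) else 0)).Local v)]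
    [BorelSpace ((UnitaryGroup.cmDatum L 3 (Matrix.of fun i j : Fin 3 => if i.val + j.val + 1 = 3 then (1 : L) else 0)).Local v)]
    [∀ γ : (UnitaryGroup.cmDatum L 3 H).Local v, MeasurableSpace (((UnitaryGroup.cmDatum L 3 H).Local v) ⧸ Subgroup.centralizer ({γ} : Set ((UnitaryGroup.cmDatum L 3 H).Local v)))]
    [∀ γ : (UnitaryGroup.cmDatum L 3 H).Local v, BorelSpace (((UnitaryGroup.cmDatum L 3 H).Local v) ⧸ Subgroup.centralizer ({γ} : Set ((UnitaryGroup.cmDatum L 3 H).Local v)))]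
    [∀ γ : (UnitaryGroup.cmDatum L 3 (Matrix.of fun i j : Fin 3 => if i.val + j.val + 1 = 3 then (1 : L) else 0)).Local v,
      MeasurableSpace (((UnitaryGroup.cmDatum L 3 (Matrix.of fun i j : Fin 3 => if i.val + j.val + 1 = 3 then (1 : L) else 0)).Local v) ⧸
        Subgroup.centralizer ({γ} : Set ((UnitaryGroup.cmDatum L 3 (Matrix.of fun i j : Fin 3 => if i.val + j.val + 1 = 3 then (1 : L) else 0)).Local v)))]
    [∀ γ : (UnitaryGroup.cmDatum L 3 (Matrix.of fun i j : Fin 3 => if i.val + j.val + 1 = 3 then (1 : L) else 0)).Local v,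
      BorelSpace (((UnitaryGroup.cmDatum L 3 (Matrix.of fun i j : Fin 3 => if i.val + j.val + 1 = 3 then (1 : L) else 0)).Local v) ⧸
        Subgroup.centralizer ({γ} : Set ((UnitaryGroup.cmDatum L 3 (Matrix.of fun i j : Fin 3 => if i.val + j.val + 1 = 3 then (1 : L) else 0)).Local v)))]
    [MeasurableSpace ((UnitaryGroup.cmDatum L 2 (Matrix.of fun i j : Fin 2 => if i.val + j.val + 1 = 2 then (1 : L) else 0)).Local v ×
      (UnitaryGroup.cmDatum L 1 (Matrix.of fun i j : Fin 1 => if i.val + j.val + 1 = 1 then (1 : L) else 0)).Local v)]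
    [BorelSpace ((UnitaryGroup.cmDatum L 2 (Matrix.of fun i j : Fin 2 => if i.val + j.val + 1 = 2 then (1 : L) else 0)).Local v ×
      (UnitaryGroup.cmDatum L 1 (Matrix.of fun i j : Fin 1 => if i.val + j.val + 1 = 1 then (1 : L) else 0)).Local v)]
    [∀ a' : (UnitaryGroup.cmDatum L 2 (Matrix.of fun i j : Fin 2 => if i.val + j.val + 1 = 2 then (1 : L) else 0)).Local v ×
        (UnitaryGroup.cmDatum L 1 (Matrix.of fun i j : Fin 1 => if i.val + j.val + 1 = 1 then (1 : L) else 0)).Local v,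
      MeasurableSpace (((UnitaryGroup.cmDatum L 2 (Matrix.of fun i j : Fin 2 => if i.val + j.val + 1 = 2 then (1 : L) else 0)).Local v ×
          (UnitaryGroup.cmDatum L 1 (Matrix.of fun i j : Fin 1 => if i.val + j.val + 1 = 1 then (1 : L) else 0)).Local v) ⧸
        Subgroup.centralizer ({a'} : Set ((UnitaryGroup.cmDatum L 2 (Matrix.of fun i j : Fin 2 => if i.val + j.val + 1 = 2 then (1 : L) else 0)).Local v ×
          (UnitaryGroup.cmDatum L 1 (Matrix.of fun i j : Fin 1 => if i.val + j.val + 1 = 1 then (1 : L) else 0)).Local v)))]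
    [∀ a' : (UnitaryGroup.cmDatum L 2 (Matrix.of fun i j : Fin 2 => if i.val + j.val + 1 = 2 then (1 : L) else 0)).Local v ×
        (UnitaryGroup.cmDatum L 1 (Matrix.of fun i j : Fin 1 => if i.val + j.val + 1 = 1 then (1 : L) else 0)).Local v,
      BorelSpace (((UnitaryGroup.cmDatum L 2 (Matrix.of fun i j : Fin 2 => if i.val + j.val + 1 = 2 then (1 : L) else 0)).Local v ×
          (UnitaryGroup.cmDatum L 1 (Matrix.of fun i j : Fin 1 => if i.val + j.val + 1 = 1 then (1 : L) else 0)).Local v) ⧸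
        Subgroup.centralizer ({a'} : Set ((UnitaryGroup.cmDatum L 2 (Matrix.of fun i j : Fin 2 => if i.val + j.val + 1 = 2 then (1 : L) else 0)).Local v ×
          (UnitaryGroup.cmDatum L 1 (Matrix.of fun i j : Fin 1 => if i.val + j.val + 1 = 1 then (1 : L) else 0)).Local v)))]
    (mHv : OrbitalMeasureFamily ((UnitaryGroup.cmDatum L 2 (Matrix.of fun i j : Fin 2 => if i.val + j.val + 1 = 2 then (1 : L) else 0)).Local v ×
      (UnitaryGroup.cmDatum L 1 (Matrix.of fun i j : Fin 1 => if i.val + j.val + 1 = 1 then (1 : L) else 0)).Local v))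
    (mGv : OrbitalMeasureFamily ((UnitaryGroup.cmDatum L 3 H).Local v))
    (νG : Measure ((UnitaryGroup.cmDatum L 3 H).Local v)) [νG.IsHaarMeasure]
    (νH : Measure ((UnitaryGroup.cmDatum L 2 (Matrix.of fun i j : Fin 2 => if i.val + j.val + 1 = 2 then (1 : L) else 0)).Local v ×
      (UnitaryGroup.cmDatum L 1 (Matrix.of fun i j : Fin 1 => if i.val + j.val + 1 = 1 then (1 : L) else 0)).Local v))
    (ξv : (UnitaryGroup.cmDatum L 2 (Matrix.of fun i j : Fin 2 => if i.val + j.val + 1 = 2 then (1 : L) else 0)).Local v ×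
      (UnitaryGroup.cmDatum L 1 (Matrix.of fun i j : Fin 1 => if i.val + j.val + 1 = 1 then (1 : L) else 0)).Local v →* ℂˣ)
    (hex : IsLocalDeltaTransferExists L H v ((finExplicitCollection L H μ (finExplicitDelta_conj_left_all L H μ) (finExplicitDelta_conj_right_all L H μ)) v) mHv mGv
      IsLocSmooth IsLocSmooth)
    (T : GL (Fin 3) (UnitaryGroup.LocalRing L v)) {a' : UnitaryGroup.LocalRing L v} (ha' : IsUnit a')
    (h' : formCongr (conjLocal L (IsCMField.complexConj L) v) T (H.map (algebraMap L (UnitaryGroup.LocalRing L v))) =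
      a' • (Matrix.of fun i j : Fin 3 => if i.val + j.val + 1 = 3 then (1 : L) else 0).map (algebraMap L (UnitaryGroup.LocalRing L v)))
    (πn : IrrClass (Gqs L v))
    (hId : CMNonsplitCharIdentityAtTestSigned L v H
      ((finExplicitCollection L H μ (finExplicitDelta_conj_left_all L H μ) (finExplicitDelta_conj_right_all L H μ)) v) mHv mGv νG νH ξv
      (if ∃ z : UnitaryGroup.LocalRing L v, IsUnit z ∧ a' = z * conjLocal L (IsCMField.complexConj L) v z then (1 : ℂ) else -1)
      (IrrClass.comap (cmDatumLocalCongr L v T ha' h').symm πn))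
    (T'' : GL (Fin 3) (UnitaryGroup.LocalRing L v)) {a'' : UnitaryGroup.LocalRing L v} (ha'' : IsUnit a'')
    (h'' : formCongr (conjLocal L (IsCMField.complexConj L) v) T''
        ((Matrix.of fun i j : Fin 3 => if i.val + j.val + 1 = 3 then (1 : L) else 0).map (algebraMap L (UnitaryGroup.LocalRing L v))) =
      a'' • (Matrix.of fun i j : Fin 3 => if i.val + j.val + 1 = 3 then (1 : L) else 0).map (algebraMap L (UnitaryGroup.LocalRing L v)))
    (hId₀ : CMNonsplitCharIdentityAtTestSigned L v (Matrix.of fun i j : Fin 3 => if i.val + j.val + 1 = 3 then (1 : L) else 0)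
      ((finExplicitCollection L (Matrix.of fun i j : Fin 3 => if i.val + j.val + 1 = 3 then (1 : L) else 0) μ
        (finExplicitDelta_conj_left_all L (Matrix.of fun i j : Fin 3 => if i.val + j.val + 1 = 3 then (1 : L) else 0) μ)
        (finExplicitDelta_conj_right_all L (Matrix.of fun i j : Fin 3 => if i.val + j.val + 1 = 3 then (1 : L) else 0) μ)) v) mHv
      (mGv.transport (cmDatumLocalCongr L v Tᵥ haᵥ hᵥ).symm.toMulEquiv (cmDatumLocalCongr L v Tᵥ haᵥ hᵥ).symm.continuous (cmDatumLocalCongr L v Tᵥ haᵥ hᵥ).continuous)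
      (νG.map (cmDatumLocalCongr L v Tᵥ haᵥ hᵥ).symm) νH ξv
      (if ∃ z : UnitaryGroup.LocalRing L v, IsUnit z ∧ a'' = z * conjLocal L (IsCMField.complexConj L) v z then (1 : ℂ) else -1)
      (IrrClass.comap (cmDatumLocalCongr L v T'' ha'' h'').symm πn))
    {c : IrrClass ((UnitaryGroup.cmDatum L 3 H).Local v)} (hc : IrrClass.comap (cmDatumLocalCongr L v Tᵥ haᵥ hᵥ) c = hId₀.πs) :
    c = hId.πs := by
  apply IrrClass.comap_injective (cmDatumLocalCongr L v Tᵥ haᵥ hᵥ)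
  rw [hc]
  exact (comap_signedPis_eq_signedPis_transport L H v μ w hw hns hH hHd Tᵥ haᵥ haσ hᵥ mHv mGv νG νH ξv hex T ha' h' πn hId T'' ha'' h'' hId₀).symm

end ValueLaw

end Summit.HodgeConjecture.HodgeConjecture.R90.S9

end
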